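import Summits.QuantumFields.YangMills.Theorems.FluctuationComparisonRegPrIntLS2BetaRelativeKeyLemmaTorus
import Summits.QuantumFields.YangMills.Theorems.FluctuationComparisonRegPrIntLS2BetaRelativeHstepHjArc
import HarnessLib

/-!
# S2β · letter (D♮)∕(D-stage) REL-TEL, the (C)-half — ★★★ THE RELATIVE KEY LEMMA TOWER ON A `d = 3` TORUS, ARC-LINEAR AND BACKGROUND-PRICED, END TO END
# (✓∕⧗`relHstep_hj_arc` at every level `t < m` ∘ ✓p825006 `relKeyLemma_torus_of_step`; supersedes ✓p825395 `relKeyLemma_torus_bkg` for px12 g24's (H♭♭)):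
# `‖δ_t‖₂ ≤ exp(Σ_{i<m}(26((d+2)L)²θ_i + ε_i∕√L))·((√L)^t·‖δ_0‖₂ + Σ_{s<t}(√L)^{t−1−s}·η_s)`, `ε_i = (κW_i·cWε_i + κA_i·cAε_i)·√N_□`,
# `η_s = (κW_s·cWβ_s + κA_s·cAβ_s + 5L³θ₀,s)·√N_b·‖bdev_s‖₂`, `κW_t = 7·10⁵((d+2)L)²θ₀,t + 2.8·10⁶β_W♯,t + 7·10⁶β_A♯,t`, `κA_t = 7·10⁵((d+2)L)²θ₀,t·(1 + 20β_A♯,t)` —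
# the OFF-DIAGONAL weight `W j u = e^{…}(√L)^{j−1−u}·η_u∕‖bdev_u‖₂` is BKG as soon as the loop supplier's bdev coefficient `cWβ_u` is (`∝ θ₀,u` by Stokes); the window
# sups `β♯` never multiply `‖bdev‖₂` except through `cWβ` or `θ₀`

Cell `ym3-torus` (rung R3 = continuum `SU(2)` Yang–Mills on the three-torus — NOT d = 4, NOT infinite volume, NOT a mass gap, NOT Clay).
Width seat «width 10» `ym3-torus-px10` (gen 23), FREE px helper on crux `stmt-QuantumFields-20520`, count-neutral, DEFINITION-FREE; own-risk brick of the px10 lane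
«(C)-half of letter (D♮)» (UV3-NODE §82; self-audit FINDING 14:09Z).  INPUTS per level `t < m` of the two `exp[mean log]` averaging towers on `SU(N)` (`P.d = 3`,
`m ≤ P.m + P.K`): FIELD history threshold `θ_t` (`PlaqSmall θ_t (M^tU)`, `((d+2)L)²θ_t ≤ 1∕800`, guard), BKG size `0 ≤ θ₀,t ≤ θ_t` (`PlaqSmall θ₀,t (M^tU₀)`), LOOP data
`0 ≤ β_W,t Q ≤ β_W♯,t ≤ 1∕12800` (four bonds' relative `loopHol`), TRANSPORT data `0 ≤ β_A,t Q ≤ β_A♯,t ≤ 1∕12800` (relative `axialAvg`, staircase), SUPPLIED by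
`β_W ≤ cWβ·Σ_{near}bdev + cWε·Σ_{near}δ`, `β_A ≤ cAβ·Σ_{near}bdev + cAε·Σ_{near}δ`; OUTPUT = the displayed tower bound for every `t ≤ m`.
* ★★★ `relKeyLemma_torus_arc`.

HONEST SCOPE.  A composition of landed∕signed letters; nothing of Bałaban's renormalisation analysis asserted or proved; on the T³ RECORD the inputs are OWED (BKG-tower
letter — px12 g24 ✓∕⧗`…BackgroundTower(Letter)`; the suppliers with `cWβ ∝ θ₀` — px21 g23; the sup profiles; `histGood` thresholds); (H♭♭)'s other rows, (D-stage), GAP♯∘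
(`stub_uniformFibreGapOrbit`), S2β, crux 20520 and `YM3TorusSU2` are NOT proved; no registered stub is closed; the Yang–Mills mass gap is NOT proved.  Sorry-free, axioms
standard.  References: T. Bałaban, CMP **98** (1985) 17–51 [Balaban1985Averaging] ((19) p.21); CMP **99** (1985) 75–102 [Balaban1985RegularSpaces] (Lemma 1 p.79,
Thm 2 p.83); CMP **109** (1987) 249–301 [Balaban1987RG1] ((0.4)–(0.8) p.253, §3 p.273).
-/

set_option autoImplicit false

noncomputable section

open Finset
open scoped BigOperators

namespace Summit.QuantumFields.YangMills.Theorems.FluctuationComparisonRegPrIntLS2BetaRelativeKeyLemmaTorusArc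

open Literature.MathematicalPhysics.QuantumFieldTheory.Balaban1983to89
open T4Continuum BlockAveraging AveragingRT
open Literature.MathematicalPhysics.QuantumFieldTheory.Balaban1983to89.ExpMeanLog (expMeanLogSU deltaSU)
open Literature.MathematicalPhysics.QuantumFieldTheory.Balaban1983to89.T4TiltOscillation (bdev)
open B10Eq47AxialChi (shiftN)
open Summit.QuantumFields.YangMills.Theorems.FluctuationComparisonRegPrIntLS2BetaRelativeKeyLemmaTorus (relKeyLemma_torus_of_step)
open Summit.QuantumFields.YangMills.Theorems.FluctuationComparisonRegPrIntLS2BetaRelativeHstepHjArc (relHstep_hj_arc)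

variable {P : Params} {n : Type*} [Fintype n] [DecidableEq n] [Nonempty n]

/-- ★★★ **THE RELATIVE KEY LEMMA TOWER ON A `d = 3` TORUS, ARC-LINEAR AND BACKGROUND-PRICED, END TO END** (`M^t := Averaging.iter (blockAvg expMeanLogSU) t`;
inputs in the module docstring).  For every `t ≤ m`:
`‖δ_t‖₂ ≤ exp(Σ_{i<m}(26·((d+2)L)²θ_i + (κW_i·cWε_i + κA_i·cAε_i)·√((3^dL^dd²)(3^dd²))∕√L))·((√L)^t·‖δ_0‖₂ + Σ_{s<t}(√L)^{t−1−s}·(κW_s·cWβ_s + κA_s·cAβ_s + 5L³θ₀,s)·√((3^dL^dd)(3^dd²))·‖bdev_s‖₂)`.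
[cite: Balaban1985Averaging, (19) p.21; Balaban1985RegularSpaces, Lemma 1 p.79] -/
theorem relKeyLemma_torus_arc (hd : P.d = 3) {m : ℕ} (hm : m ≤ P.m + P.K) (U U₀ : GaugeField P 0 (Matrix.specialUnitaryGroup n ℂ))
    (θ θ₀ βWs βAs cWβ cWε cAβ cAε : ℕ → ℝ) (hθ₀0 : ∀ t, t < m → 0 ≤ θ₀ t) (hθ₀θ : ∀ t, t < m → θ₀ t ≤ θ t)
    (hθ : ∀ t, t < m → (((P.d + 2) * P.L : ℕ) : ℝ) ^ 2 * θ t ≤ 1 / 800) (hδ : ∀ t, t < m → (((P.d + 2) * P.L : ℕ) : ℝ) ^ 2 / 4 * θ t < deltaSU n)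
    (hU : ∀ t, t < m → PlaqSmall (θ t) (Averaging.iter (fun k => blockAvg (P := P) (j := k) (expMeanLogSU (n := n))) t U))
    (hU₀ : ∀ t, t < m → PlaqSmall (θ₀ t) (Averaging.iter (fun k => blockAvg (P := P) (j := k) (expMeanLogSU (n := n))) t U₀))
    (βW βA : (t : ℕ) → Plaq P (t + 1) → ℝ) (hβW0 : ∀ t, t < m → ∀ Q, 0 ≤ βW t Q) (hβA0 : ∀ t, t < m → ∀ Q, 0 ≤ βA t Q)
    (hβWs0 : ∀ t, t < m → 0 ≤ βWs t) (hβAs0 : ∀ t, t < m → 0 ≤ βAs t) (hβWsup : ∀ t, t < m → ∀ Q, βW t Q ≤ βWs t) (hβAsup : ∀ t, t < m → ∀ Q, βA t Q ≤ βAs t)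
    (hβWs : ∀ t, t < m → βWs t ≤ 1 / 12800) (hβAs : ∀ t, t < m → βAs t ≤ 1 / 12800)
    (hcWβ : ∀ t, t < m → 0 ≤ cWβ t) (hcWε : ∀ t, t < m → 0 ≤ cWε t) (hcAβ : ∀ t, t < m → 0 ≤ cAβ t) (hcAε : ∀ t, t < m → 0 ≤ cAε t)
    (hW : ∀ t, t < m → ∀ (Q : Plaq P (t + 1)) (c : PBond P (t + 1)), (c = ⟨Q.src, Q.μ⟩ ∨ c = ⟨Q.src.shift Q.μ, Q.ν⟩ ∨ c = ⟨Q.src.shift Q.ν, Q.μ⟩ ∨ c = ⟨Q.src, Q.ν⟩) →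
      ∀ i, dist1 ((loopHol (Averaging.iter (fun k => blockAvg (P := P) (j := k) (expMeanLogSU (n := n))) t U₀) c i)⁻¹ *
        loopHol (Averaging.iter (fun k => blockAvg (P := P) (j := k) (expMeanLogSU (n := n))) t U) c i) ≤ βW t Q)
    (hA : ∀ t, t < m → ∀ (Q : Plaq P (t + 1)) (c : PBond P (t + 1)), (c = ⟨Q.src, Q.μ⟩ ∨ c = ⟨Q.src.shift Q.μ, Q.ν⟩ ∨ c = ⟨Q.src.shift Q.ν, Q.μ⟩ ∨ c = ⟨Q.src, Q.ν⟩) →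
      dist1 ((axialAvg (Averaging.iter (fun k => blockAvg (P := P) (j := k) (expMeanLogSU (n := n))) t U₀) c)⁻¹ *
        axialAvg (Averaging.iter (fun k => blockAvg (P := P) (j := k) (expMeanLogSU (n := n))) t U) c) ≤ βA t Q)
    (hS : ∀ t, t < m → ∀ (Q : Plaq P (t + 1)) (i : Idx P),
      dist1 ((holAt (Averaging.iter (fun k => blockAvg (P := P) (j := k) (expMeanLogSU (n := n))) t U₀) (walk (emb Q.src) (stairWord i.2.1 (off i.1))))⁻¹ *
        holAt (Averaging.iter (fun k => blockAvg (P := P) (j := k) (expMeanLogSU (n := n))) t U) (walk (emb Q.src) (stairWord i.2.1 (off i.1)))) ≤ βA t Q)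
    (hβWsupp : ∀ t, t < m → ∀ Q : Plaq P (t + 1), βW t Q ≤
      cWβ t * ∑ c ∈ Finset.univ.filter (fun c : PBond P t => ∀ κ, blockOf c.src κ = Q.src κ ∨ blockOf c.src κ = Q.src κ + 1 ∨ blockOf c.src κ = Q.src κ - 1),
        dist1 (bdev (Averaging.iter (fun k => blockAvg (P := P) (j := k) (expMeanLogSU (n := n))) t U)
          (Averaging.iter (fun k => blockAvg (P := P) (j := k) (expMeanLogSU (n := n))) t U₀) c) +
      cWε t * ∑ q ∈ Finset.univ.filter (fun q : Plaq P t => ∀ κ, blockOf q.src κ = Q.src κ ∨ blockOf q.src κ = Q.src κ + 1 ∨ blockOf q.src κ = Q.src κ - 1),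
        dist1 ((GaugeField.plaqHol (Averaging.iter (fun k => blockAvg (P := P) (j := k) (expMeanLogSU (n := n))) t U₀) q)⁻¹ *
          GaugeField.plaqHol (Averaging.iter (fun k => blockAvg (P := P) (j := k) (expMeanLogSU (n := n))) t U) q))
    (hβAsupp : ∀ t, t < m → ∀ Q : Plaq P (t + 1), βA t Q ≤
      cAβ t * ∑ c ∈ Finset.univ.filter (fun c : PBond P t => ∀ κ, blockOf c.src κ = Q.src κ ∨ blockOf c.src κ = Q.src κ + 1 ∨ blockOf c.src κ = Q.src κ - 1),
        dist1 (bdev (Averaging.iter (fun k => blockAvg (P := P) (j := k) (expMeanLogSU (n := n))) t U)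
          (Averaging.iter (fun k => blockAvg (P := P) (j := k) (expMeanLogSU (n := n))) t U₀) c) +
      cAε t * ∑ q ∈ Finset.univ.filter (fun q : Plaq P t => ∀ κ, blockOf q.src κ = Q.src κ ∨ blockOf q.src κ = Q.src κ + 1 ∨ blockOf q.src κ = Q.src κ - 1),
        dist1 ((GaugeField.plaqHol (Averaging.iter (fun k => blockAvg (P := P) (j := k) (expMeanLogSU (n := n))) t U₀) q)⁻¹ *
          GaugeField.plaqHol (Averaging.iter (fun k => blockAvg (P := P) (j := k) (expMeanLogSU (n := n))) t U) q)) :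
    ∀ t, t ≤ m →
      √(∑ p : Plaq P t, dist1 ((GaugeField.plaqHol (Averaging.iter (fun k => blockAvg (P := P) (j := k) (expMeanLogSU (n := n))) t U₀) p)⁻¹ *
          GaugeField.plaqHol (Averaging.iter (fun k => blockAvg (P := P) (j := k) (expMeanLogSU (n := n))) t U) p) ^ 2) ≤
        Real.exp (∑ i ∈ range m, (26 * ((((P.d + 2) * P.L : ℕ) : ℝ) ^ 2 * θ i) +
            ((700000 * ((((P.d + 2) * P.L : ℕ) : ℝ) ^ 2 * θ₀ i) + 2800000 * βWs i + 7000000 * βAs i) * cWε i + (700000 * ((((P.d + 2) * P.L : ℕ) : ℝ) ^ 2 * θ₀ i) + 14000000 * ((((P.d + 2) * P.L : ℕ) : ℝ) ^ 2 * θ₀ i) * βAs i) * cAε i) *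
              √(((3 ^ P.d * P.L ^ P.d * P.d ^ 2 : ℕ) : ℝ) * ((3 ^ P.d * P.d ^ 2 : ℕ) : ℝ)) / Real.sqrt (P.L : ℝ))) *
          (Real.sqrt (P.L : ℝ) ^ t * √(∑ p : Plaq P 0, dist1 ((GaugeField.plaqHol U₀ p)⁻¹ * GaugeField.plaqHol U p) ^ 2) +
            ∑ s ∈ range t, Real.sqrt (P.L : ℝ) ^ (t - 1 - s) *
              (((700000 * ((((P.d + 2) * P.L : ℕ) : ℝ) ^ 2 * θ₀ s) + 2800000 * βWs s + 7000000 * βAs s) * cWβ s + (700000 * ((((P.d + 2) * P.L : ℕ) : ℝ) ^ 2 * θ₀ s) + 14000000 * ((((P.d + 2) * P.L : ℕ) : ℝ) ^ 2 * θ₀ s) * βAs s) * cAβ s + 5 * (P.L : ℝ) ^ 3 * θ₀ s) *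
                √(((3 ^ P.d * P.L ^ P.d * P.d : ℕ) : ℝ) * ((3 ^ P.d * P.d ^ 2 : ℕ) : ℝ)) *
                √(∑ c : PBond P s, dist1 (bdev (Averaging.iter (fun k => blockAvg (P := P) (j := k) (expMeanLogSU (n := n))) s U)
                  (Averaging.iter (fun k => blockAvg (P := P) (j := k) (expMeanLogSU (n := n))) s U₀) c) ^ 2))) := by
  have hlev : ∀ t, t < m → t + 1 ≤ P.m + P.K := fun t ht => by omega
  -- the per-level `hstep`∕`hj` pair (✓`relHstep_hj_arc` at level `t` on the pair `(M^tU, M^tU₀)`)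
  have H := fun t (ht : t < m) => relHstep_hj_arc (hlev t ht)
    (Averaging.iter (fun k => blockAvg (P := P) (j := k) (expMeanLogSU (n := n))) t U)
    (Averaging.iter (fun k => blockAvg (P := P) (j := k) (expMeanLogSU (n := n))) t U₀)
    (hθ₀0 t ht) (hθ₀θ t ht) (hθ t ht) (hδ t ht) (hU t ht) (hU₀ t ht) (βW t) (βA t) (hβW0 t ht) (hβA0 t ht) (hβWs0 t ht) (hβAs0 t ht)
    (hβWsup t ht) (hβAsup t ht) (hβWs t ht) (hβAs t ht) (hcWβ t ht) (hcWε t ht) (hcAβ t ht) (hcAε t ht) (hW t ht) (hA t ht) (hS t ht) (hβWsupp t ht) (hβAsupp t ht)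
  have hθ0 : ∀ t, t < m → 0 ≤ (((P.d + 2) * P.L : ℕ) : ℝ) ^ 2 * θ t := fun t ht =>
    mul_nonneg (sq_nonneg _) ((hθ₀0 t ht).trans (hθ₀θ t ht))
  have hκW0 : ∀ t, t < m → 0 ≤ (700000 * ((((P.d + 2) * P.L : ℕ) : ℝ) ^ 2 * θ₀ t) + 2800000 * βWs t + 7000000 * βAs t) := fun t ht => by
    have := hθ₀0 t ht; have := hβWs0 t ht; have := hβAs0 t ht; positivity
  have hκA0 : ∀ t, t < m → 0 ≤ (700000 * ((((P.d + 2) * P.L : ℕ) : ℝ) ^ 2 * θ₀ t) + 14000000 * ((((P.d + 2) * P.L : ℕ) : ℝ) ^ 2 * θ₀ t) * βAs t) := fun t ht => by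
    have := hθ₀0 t ht; have := hβAs0 t ht; positivity
  exact relKeyLemma_torus_of_step hd (expMeanLogSU (n := n)) hm U U₀ (fun t => (((P.d + 2) * P.L : ℕ) : ℝ) ^ 2 * θ t)
    (fun t => ((700000 * ((((P.d + 2) * P.L : ℕ) : ℝ) ^ 2 * θ₀ t) + 2800000 * βWs t + 7000000 * βAs t) * cWε t + (700000 * ((((P.d + 2) * P.L : ℕ) : ℝ) ^ 2 * θ₀ t) + 14000000 * ((((P.d + 2) * P.L : ℕ) : ℝ) ^ 2 * θ₀ t) * βAs t) * cAε t) *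
      √(((3 ^ P.d * P.L ^ P.d * P.d ^ 2 : ℕ) : ℝ) * ((3 ^ P.d * P.d ^ 2 : ℕ) : ℝ)))
    (fun s => ((700000 * ((((P.d + 2) * P.L : ℕ) : ℝ) ^ 2 * θ₀ s) + 2800000 * βWs s + 7000000 * βAs s) * cWβ s + (700000 * ((((P.d + 2) * P.L : ℕ) : ℝ) ^ 2 * θ₀ s) + 14000000 * ((((P.d + 2) * P.L : ℕ) : ℝ) ^ 2 * θ₀ s) * βAs s) * cAβ s + 5 * (P.L : ℝ) ^ 3 * θ₀ s) *
      √(((3 ^ P.d * P.L ^ P.d * P.d : ℕ) : ℝ) * ((3 ^ P.d * P.d ^ 2 : ℕ) : ℝ)) *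
      √(∑ c : PBond P s, dist1 (bdev (Averaging.iter (fun k => blockAvg (P := P) (j := k) (expMeanLogSU (n := n))) s U)
        (Averaging.iter (fun k => blockAvg (P := P) (j := k) (expMeanLogSU (n := n))) s U₀) c) ^ 2))
    hθ0 (fun t ht => by have := hκW0 t ht; have := hκA0 t ht; have := hcWε t ht; have := hcAε t ht; positivity)
    (fun t ht => by have := hκW0 t ht; have := hκA0 t ht; have := hcWβ t ht; have := hcAβ t ht; have := hθ₀0 t ht; positivity) (by norm_num : (0 : ℝ) ≤ 26)
    (fun t Q => (700000 * ((((P.d + 2) * P.L : ℕ) : ℝ) ^ 2 * θ₀ t) + 2800000 * βWs t + 7000000 * βAs t) * βW t Q + (700000 * ((((P.d + 2) * P.L : ℕ) : ℝ) ^ 2 * θ₀ t) + 14000000 * ((((P.d + 2) * P.L : ℕ) : ℝ) ^ 2 * θ₀ t) * βAs t) * βA t Q +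
      5 * (P.L : ℝ) ^ 3 * θ₀ t * ∑ c ∈ Finset.univ.filter (fun c : PBond P t => ∀ κ, blockOf c.src κ = Q.src κ ∨ blockOf c.src κ = Q.src κ + 1),
        dist1 (bdev (Averaging.iter (fun k => blockAvg (P := P) (j := k) (expMeanLogSU (n := n))) t U)
          (Averaging.iter (fun k => blockAvg (P := P) (j := k) (expMeanLogSU (n := n))) t U₀) c))
    (fun t ht Q => (H t ht).1 Q) (fun t ht => (H t ht).2)

end Summit.QuantumFields.YangMills.Theorems.FluctuationComparisonRegPrIntLS2BetaRelativeKeyLemmaTorusArc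

end
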